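import Mathlib
import HarnessLib

/-!
# Lanes: non-crossing routing of four alternating arms from their tips to prescribed landing sides

Topic `Literature/Probability/Percolation`; family `crit-perc` / near-critical percolation on `𝕋`.
A purely combinatorial brick of the near-critical arm-separation theorem for four arms of
alternating colours (P. Nolin, *Near-critical percolation in two dimensions*, EJP 13 (2008),
Thm. 11 for `j = 4`, `σ = BWBW` [arXiv 0711.4948: Thm. 10]; H. Kesten, CMP 109 (1987),
Lemmas 4–6). In the landing step of the external extremities (Nolin 2008, §4.4, p. 12: "there exist
universal constants `C₁(η')`, `C₂(η')` … such that we can choose some `I_{η'}` … and then go to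
`I_{η'₀}` on the next scale with cost `C₂(η')`"; Prop. 12 (i), "straightforward" from RSW and the
generalised FKG inequality) four fenced tips in ARBITRARY positions around `∂Λ_{2M}` — in the
certified alternating cyclic order — must be joined to the four prescribed landing areas of
`∂Λ_{4M}` by four corridors with pairwise disjoint supports. Each corridor is a spoke from the tip to
a ring road, an arc of that ring, and an approach tube from the ring to the target; two corridors on
rings `ℓ < ℓ'` are disjoint as soon as the arc on the ring `ℓ` avoids the spoke of the other arm and
the arc on the ring `ℓ'` avoids the approach tube of the first. This file isolates the two order-theoretic
facts which make such a choice possible; no geometry and no probability enters.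

* `cyc P y x` — the anticlockwise distance from `y` to `x` on a cycle of perimeter `P`
  (both in `[0, P)`), `cyc_range`, `cyc_pos_of_ne`, `cyc_self`, `cyc_rebase`;
* **`rotate_cyclic`** (`rotate_linear`, `exists_first`) — four points of a cycle listed in cyclic
  order stay in cyclic order when the list is started at the first of them after any base point;
* **`exists_cut`** — *the cut*: given four tips in cyclic order with alternating colours and four
  targets in cyclic order with alternating colours, all at mutual cyclic distance `≥ 2h`, `h ≥ 1`,
  there is a cut point `c` (at distance `h` before or after the tip `0`) and rotations `jt`, `kt`
  of the two lists such that, read anticlockwise from `c`, the tips come as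
  `τ (jt), τ (jt+1), …`, the targets as `γ (kt), γ (kt+1), …`, every object at distance `≥ h` from
  the cut, and the colours of `τ (jt)` and `γ (kt)` agree — so that matching the `q`-th tip with
  the `q`-th target after the cut respects the colours (the "first object after the cut" changes
  colour when the cut crosses a tip, not when it does not);
* **`lanes_linear`** — *the lanes*: on a line, tips `T 0 < T 1 < T 2 < T 3` matched with targets
  `G 0 < G 1 < G 2 < G 3`; give the arm `q` the level `3 - q` if it moves right (`T q < G q`) and
  `4 + q` if it moves left. Then for `q ≠ q'`: if the level of `q'` is higher, the tip `T q'` is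
  outside the hull `[min (T q) (G q), max (T q) (G q)]` of the arm `q` (the spoke of `q'` crosses
  the ring of `q` off its arc), and if the level of `q'` is lower, the target `G q'` is outside that
  hull (the approach tube of `q'` crosses the ring of `q` off its arc). Eight levels are allowed
  (eight ring roads), which makes the level map trivially injective (`laneLevel_injective`).

Everything here is proved; no named facts are introduced.

## References

* P. Nolin, Near-critical percolation in two dimensions, *Electron. J. Probab.* 13 (2008), §4.3
  Prop. 12 (i), §4.4 (arXiv 0711.4948: Prop. 11, proof of Thm. 10, p. 12) [Nolin2008].
* H. Kesten, Scaling relations for 2D-percolation, *Comm. Math. Phys.* 109 (1987), Lemma 2,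
  Lemmas 4–6 [Kesten1987].
-/

namespace Literature.Probability.Percolation

namespace Lanes

/-! ### Cyclic distance -/

/-- **Anticlockwise distance** from `y` to `x` on a cycle of perimeter `P` (both meant in `[0, P)`). [folklore] -/
def cyc (P y x : ℤ) : ℤ := if y ≤ x then x - y else x - y + P

/-- The cyclic distance of points of `[0, P)` lies in `[0, P)`. [folklore] -/
theorem cyc_range {P y x : ℤ} (hy : 0 ≤ y) (hyP : y < P) (hx : 0 ≤ x) (hxP : x < P) : 0 ≤ cyc P y x ∧ cyc P y x < P := by
  unfold cyc; split_ifs <;> omega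

/-- `cyc P x x = 0`. [folklore] -/
theorem cyc_self (P x : ℤ) : cyc P x x = 0 := by
  unfold cyc; rw [if_pos le_rfl, sub_self]

/-- The cyclic distance between distinct points is positive. [folklore] -/
theorem cyc_pos_of_ne {P y x : ℤ} (hyP : y < P) (hx : 0 ≤ x) (hne : x ≠ y) : 0 < cyc P y x := by
  unfold cyc; split_ifs <;> omega

/-- The cyclic distance from a fixed point is injective on `[0, P)`. [folklore] -/
theorem eq_of_cyc_eq {P y x x' : ℤ} (hx : 0 ≤ x ∧ x < P) (hx' : 0 ≤ x' ∧ x' < P)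
    (h : cyc P y x = cyc P y x') : x = x' := by
  unfold cyc at h; split_ifs at h <;> omega

/-- **Rebasing**: the cyclic distance is invariant under the rotation taking `o` to `0`. [folklore] -/
theorem cyc_rebase {P o y x : ℤ} (ho : 0 ≤ o ∧ o < P) (hy : 0 ≤ y ∧ y < P) (hx : 0 ≤ x ∧ x < P) :
    cyc P y x = cyc P (cyc P o y) (cyc P o x) := by
  unfold cyc; split_ifs <;> omega

/-! ### Starting a cyclic list at the first point after a base point -/

/-- **Rotating a cyclic order, linear form.** Points `0 = u 0 < u 1 < u 2 < u 3 < P` and a base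
point `β ∈ (0, P)` off them: if `k` minimises the anticlockwise distance `cyc P β (u i)`, the list
started at `k` is in increasing distance from `β`. [folklore] -/
theorem rotate_linear {P β : ℤ} {u : Fin 4 → ℤ} (hu0 : u 0 = 0) (h01 : u 0 < u 1) (h12 : u 1 < u 2) (h23 : u 2 < u 3)
    (h3 : u 3 < P) (hβ : 0 < β ∧ β < P) (hβu : ∀ i, u i ≠ β) {k : Fin 4} (hk : ∀ i, cyc P β (u k) ≤ cyc P β (u i)) :
    cyc P β (u k) < cyc P β (u (k + 1)) ∧ cyc P β (u (k + 1)) < cyc P β (u (k + 2)) ∧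
      cyc P β (u (k + 2)) < cyc P β (u (k + 3)) := by
  have hb1 := hβu 1; have hb2 := hβu 2; have hb3 := hβu 3
  have hk0 := hk 0; have hk1 := hk 1; have hk2 := hk 2; have hk3 := hk 3
  have hk' : k = 0 ∨ k = 1 ∨ k = 2 ∨ k = 3 := by fin_cases k <;> simp
  rcases hk' with rfl | rfl | rfl | rfl
  · show cyc P β (u 0) < cyc P β (u 1) ∧ cyc P β (u 1) < cyc P β (u 2) ∧ cyc P β (u 2) < cyc P β (u 3)
    unfold cyc at *; split_ifs at * <;> omega
  · show cyc P β (u 1) < cyc P β (u 2) ∧ cyc P β (u 2) < cyc P β (u 3) ∧ cyc P β (u 3) < cyc P β (u 0)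
    unfold cyc at *; split_ifs at * <;> omega
  · show cyc P β (u 2) < cyc P β (u 3) ∧ cyc P β (u 3) < cyc P β (u 0) ∧ cyc P β (u 0) < cyc P β (u 1)
    unfold cyc at *; split_ifs at * <;> omega
  · show cyc P β (u 3) < cyc P β (u 0) ∧ cyc P β (u 0) < cyc P β (u 1) ∧ cyc P β (u 1) < cyc P β (u 2)
    unfold cyc at *; split_ifs at * <;> omega

/-- **Rotating a cyclic order.** Four points `x 0, …, x 3` of `[0, P)` in anticlockwise cyclic order
(`cyc (x 0) (x 1) < cyc (x 0) (x 2) < cyc (x 0) (x 3)`, `x 1 ≠ x 0`) and a base point `b ∈ [0, P)` off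
the four: if `k` is the first point after `b` (its anticlockwise distance from `b` is minimal), the list
started at `k` is in increasing distance from `b` (rebase at `x 0` and `rotate_linear`). [folklore] -/
theorem rotate_cyclic {P b : ℤ} {x : Fin 4 → ℤ} (hx : ∀ i, 0 ≤ x i ∧ x i < P) (hb : 0 ≤ b ∧ b < P)
    (hbx : ∀ i, x i ≠ b) (h01 : cyc P (x 0) (x 1) < cyc P (x 0) (x 2)) (h12 : cyc P (x 0) (x 2) < cyc P (x 0) (x 3))
    (h1 : 0 < cyc P (x 0) (x 1)) {k : Fin 4} (hk : ∀ i, cyc P b (x k) ≤ cyc P b (x i)) :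
    cyc P b (x k) < cyc P b (x (k + 1)) ∧ cyc P b (x (k + 1)) < cyc P b (x (k + 2)) ∧
      cyc P b (x (k + 2)) < cyc P b (x (k + 3)) := by
  have key : ∀ i, cyc P b (x i) = cyc P (cyc P (x 0) b) (cyc P (x 0) (x i)) := fun i => cyc_rebase (hx 0) hb (hx i)
  simp only [key] at hk ⊢
  have hβ := cyc_range (hx 0).1 (hx 0).2 hb.1 hb.2
  have hβ0 : 0 < cyc P (x 0) b := cyc_pos_of_ne (hx 0).2 hb.1 (hbx 0).symm
  have h3 := cyc_range (hx 0).1 (hx 0).2 (hx 3).1 (hx 3).2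
  refine rotate_linear (u := fun i => cyc P (x 0) (x i)) (cyc_self P (x 0)) (by rw [cyc_self]; exact h1) h01 h12 h3.2
    ⟨hβ0, hβ.2⟩ (fun i heq => hbx i (eq_of_cyc_eq (hx i) hb heq)) hk

/-- **The first point after a base point exists** (four points, minimal anticlockwise distance). [folklore] -/
theorem exists_first (P b : ℤ) (x : Fin 4 → ℤ) : ∃ k : Fin 4, ∀ i, cyc P b (x k) ≤ cyc P b (x i) := by
  obtain ⟨k, -, hk⟩ := Finset.exists_min_image Finset.univ (fun i : Fin 4 => cyc P b (x i)) ⟨0, Finset.mem_univ _⟩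
  exact ⟨k, fun i => hk i (Finset.mem_univ _)⟩

/-! ### The cut -/

/-- **The cut.** Tips `τ 0, …, τ 3 ∈ [0, P)` in anticlockwise cyclic order from `τ 0`, of
alternating colours (`τ j` has colour `c₀ xor (j odd)`), and targets `γ 0, …, γ 3 ∈ [0, P)` in
anticlockwise cyclic order from `γ 0`, of alternating colours (`γ k` open iff `k` even), every
target at cyclic distance `≥ 2h` from the tip `τ 0` in both directions, `τ 1` at distance `≥ 2h`
after `τ 0` and `τ 3` at distance `≥ 2h` before it (`1 ≤ h`). Then there are a cut `c ∈ [0, P)`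
and rotations `jt, kt : Fin 4` such that, with `lin x = cyc P c x` the anticlockwise distance from the
cut: the tips read `lin (τ jt) < lin (τ (jt+1)) < lin (τ (jt+2)) < lin (τ (jt+3))`, the targets read
`lin (γ kt) < … < lin (γ (kt+3))`, all eight at distance `≥ h` from the cut on both sides
(`h ≤ lin x ≤ P - h`), and the colours of the first tip and the first target agree:
`(c₀ xor decide (jt odd)) = decide (kt even)`. The cut is `τ 0 - h` (first tip `τ 0`) or
`τ 0 + h` (first tip `τ 1`); the first target after either is the same, and exactly one of the two
parities fits. [cite: Nolin2008, §4.3 Prop. 12 (i) and §4.4 p. 12 (arXiv 0711.4948: Prop. 11; relocation of landing areas)] -/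
theorem exists_cut {P h : ℤ} (hh : 1 ≤ h) {τ γ : Fin 4 → ℤ} (c₀ : Bool)
    (hτ : ∀ j, 0 ≤ τ j ∧ τ j < P) (hγ : ∀ k, 0 ≤ γ k ∧ γ k < P)
    (hτcyc : cyc P (τ 0) (τ 1) < cyc P (τ 0) (τ 2) ∧ cyc P (τ 0) (τ 2) < cyc P (τ 0) (τ 3))
    (hγcyc : cyc P (γ 0) (γ 1) < cyc P (γ 0) (γ 2) ∧ cyc P (γ 0) (γ 2) < cyc P (γ 0) (γ 3))
    (hγ1 : 0 < cyc P (γ 0) (γ 1))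
    (hsepτ : 2 * h ≤ cyc P (τ 0) (τ 1) ∧ cyc P (τ 0) (τ 3) ≤ P - 2 * h)
    (hsepγ : ∀ k, 2 * h ≤ cyc P (τ 0) (γ k) ∧ cyc P (τ 0) (γ k) ≤ P - 2 * h) :
    ∃ c : ℤ, 0 ≤ c ∧ c < P ∧ ∃ jt kt : Fin 4,
      (cyc P c (τ jt) < cyc P c (τ (jt + 1)) ∧ cyc P c (τ (jt + 1)) < cyc P c (τ (jt + 2)) ∧
        cyc P c (τ (jt + 2)) < cyc P c (τ (jt + 3))) ∧
      (cyc P c (γ kt) < cyc P c (γ (kt + 1)) ∧ cyc P c (γ (kt + 1)) < cyc P c (γ (kt + 2)) ∧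
        cyc P c (γ (kt + 2)) < cyc P c (γ (kt + 3))) ∧
      (∀ j, h ≤ cyc P c (τ j) ∧ cyc P c (τ j) ≤ P - h) ∧ (∀ k, h ≤ cyc P c (γ k) ∧ cyc P c (γ k) ≤ P - h) ∧
      (xor c₀ (decide ((jt : ℕ) % 2 = 1)) = decide ((kt : ℕ) % 2 = 0)) := by
  have hτ0 := hτ 0; have hτ1 := hτ 1; have hτ2 := hτ 2; have hτ3 := hτ 3
  have hγ0 := hγ 0; have hγ1' := hγ 1; have hγ2 := hγ 2; have hγ3 := hγ 3
  -- the first target after `τ 0`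
  obtain ⟨kt, hkt⟩ := exists_first P (τ 0) γ
  have hγne : ∀ k, γ k ≠ τ 0 := fun k heq => by
    have := (hsepγ k).1
    rw [heq, cyc_self] at this
    omega
  have hrot := rotate_cyclic (P := P) (b := τ 0) hγ hτ0 hγne hγcyc.1 hγcyc.2 hγ1 hkt
  have hP : 4 * h ≤ P := by have := (hsepγ 0).1; have := (hsepγ 0).2; omega
  -- the two candidate cuts and their linear coordinates
  -- `c⁻ = τ 0 - h` (mod `P`): `lin⁻ x = cyc (τ 0) x + h` for `x` at distance `≤ P - 2h`, and `lin⁻ (τ 0) = h`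
  -- `c⁺ = τ 0 + h` (mod `P`): `lin⁺ x = cyc (τ 0) x - h` for `x` at distance `≥ 2h`, and `lin⁺ (τ 0) = P - h`
  set cm : ℤ := if h ≤ τ 0 then τ 0 - h else τ 0 - h + P with hcm
  set cp : ℤ := if τ 0 + h < P then τ 0 + h else τ 0 + h - P with hcp
  have hcm_range : 0 ≤ cm ∧ cm < P := by rw [hcm]; split_ifs <;> omega
  have hcp_range : 0 ≤ cp ∧ cp < P := by rw [hcp]; split_ifs <;> omega
  have linm : ∀ x, 0 ≤ x → x < P → cyc P (τ 0) x ≤ P - 2 * h → cyc P cm x = cyc P (τ 0) x + h := by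
    intro x hx hxP hd
    rw [hcm]; unfold cyc at hd ⊢; split_ifs at hd ⊢ <;> omega
  have linp : ∀ x, 0 ≤ x → x < P → 2 * h ≤ cyc P (τ 0) x → cyc P cp x = cyc P (τ 0) x - h := by
    intro x hx hxP hd
    rw [hcp]; unfold cyc at hd ⊢; split_ifs at hd ⊢ <;> omega
  have linm0 : cyc P cm (τ 0) = h := by rw [hcm]; unfold cyc; split_ifs <;> omega
  have linp0 : cyc P cp (τ 0) = P - h := by rw [hcp]; unfold cyc; split_ifs <;> omega
  -- distances of the tips from `τ 0`
  have hd1 : 2 * h ≤ cyc P (τ 0) (τ 1) ∧ cyc P (τ 0) (τ 1) ≤ P - 2 * h := ⟨hsepτ.1, by linarith [hτcyc.1, hτcyc.2, hsepτ.2]⟩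
  have hd2 : 2 * h ≤ cyc P (τ 0) (τ 2) ∧ cyc P (τ 0) (τ 2) ≤ P - 2 * h := ⟨by linarith [hτcyc.1, hsepτ.1], by linarith [hτcyc.2, hsepτ.2]⟩
  have hd3 : 2 * h ≤ cyc P (τ 0) (τ 3) ∧ cyc P (τ 0) (τ 3) ≤ P - 2 * h := ⟨by linarith [hτcyc.1, hτcyc.2, hsepτ.1], hsepτ.2⟩
  -- targets read the same from both cuts
  have tgtm : ∀ k, cyc P cm (γ k) = cyc P (τ 0) (γ k) + h := fun k => linm (γ k) (hγ k).1 (hγ k).2 (hsepγ k).2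
  have tgtp : ∀ k, cyc P cp (γ k) = cyc P (τ 0) (γ k) - h := fun k => linp (γ k) (hγ k).1 (hγ k).2 (hsepγ k).1
  have tgt_orderm : cyc P cm (γ kt) < cyc P cm (γ (kt + 1)) ∧ cyc P cm (γ (kt + 1)) < cyc P cm (γ (kt + 2)) ∧
      cyc P cm (γ (kt + 2)) < cyc P cm (γ (kt + 3)) := by
    rw [tgtm, tgtm, tgtm, tgtm]; exact ⟨by linarith [hrot.1], by linarith [hrot.2.1], by linarith [hrot.2.2]⟩
  have tgt_orderp : cyc P cp (γ kt) < cyc P cp (γ (kt + 1)) ∧ cyc P cp (γ (kt + 1)) < cyc P cp (γ (kt + 2)) ∧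
      cyc P cp (γ (kt + 2)) < cyc P cp (γ (kt + 3)) := by
    rw [tgtp, tgtp, tgtp, tgtp]; exact ⟨by linarith [hrot.1], by linarith [hrot.2.1], by linarith [hrot.2.2]⟩
  have tgt_farm : ∀ k, h ≤ cyc P cm (γ k) ∧ cyc P cm (γ k) ≤ P - h := fun k => by
    rw [tgtm]; constructor <;> linarith [(hsepγ k).1, (hsepγ k).2]
  have tgt_farp : ∀ k, h ≤ cyc P cp (γ k) ∧ cyc P cp (γ k) ≤ P - h := fun k => by
    rw [tgtp]; constructor <;> linarith [(hsepγ k).1, (hsepγ k).2]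
  -- tips
  have tip_farm : ∀ j, h ≤ cyc P cm (τ j) ∧ cyc P cm (τ j) ≤ P - h := by
    intro j; fin_cases j
    · show h ≤ cyc P cm (τ 0) ∧ cyc P cm (τ 0) ≤ P - h; rw [linm0]; constructor <;> linarith
    · show h ≤ cyc P cm (τ 1) ∧ cyc P cm (τ 1) ≤ P - h
      rw [linm (τ 1) hτ1.1 hτ1.2 hd1.2]; constructor <;> linarith [hd1.1, hd1.2]
    · show h ≤ cyc P cm (τ 2) ∧ cyc P cm (τ 2) ≤ P - h
      rw [linm (τ 2) hτ2.1 hτ2.2 hd2.2]; constructor <;> linarith [hd2.1, hd2.2]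
    · show h ≤ cyc P cm (τ 3) ∧ cyc P cm (τ 3) ≤ P - h
      rw [linm (τ 3) hτ3.1 hτ3.2 hd3.2]; constructor <;> linarith [hd3.1, hd3.2]
  have tip_farp : ∀ j, h ≤ cyc P cp (τ j) ∧ cyc P cp (τ j) ≤ P - h := by
    intro j; fin_cases j
    · show h ≤ cyc P cp (τ 0) ∧ cyc P cp (τ 0) ≤ P - h; rw [linp0]; constructor <;> linarith
    · show h ≤ cyc P cp (τ 1) ∧ cyc P cp (τ 1) ≤ P - h
      rw [linp (τ 1) hτ1.1 hτ1.2 hd1.1]; constructor <;> linarith [hd1.1, hd1.2]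
    · show h ≤ cyc P cp (τ 2) ∧ cyc P cp (τ 2) ≤ P - h
      rw [linp (τ 2) hτ2.1 hτ2.2 hd2.1]; constructor <;> linarith [hd2.1, hd2.2]
    · show h ≤ cyc P cp (τ 3) ∧ cyc P cp (τ 3) ≤ P - h
      rw [linp (τ 3) hτ3.1 hτ3.2 hd3.1]; constructor <;> linarith [hd3.1, hd3.2]
  have tip_orderm : cyc P cm (τ 0) < cyc P cm (τ (0 + 1)) ∧ cyc P cm (τ (0 + 1)) < cyc P cm (τ (0 + 2)) ∧
      cyc P cm (τ (0 + 2)) < cyc P cm (τ (0 + 3)) := by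
    simp only [show (0 : Fin 4) + 1 = 1 from rfl, show (0 : Fin 4) + 2 = 2 from rfl, show (0 : Fin 4) + 3 = 3 from rfl]
    rw [linm0, linm (τ 1) hτ1.1 hτ1.2 hd1.2, linm (τ 2) hτ2.1 hτ2.2 hd2.2, linm (τ 3) hτ3.1 hτ3.2 hd3.2]
    exact ⟨by linarith [hd1.1], by linarith [hτcyc.1], by linarith [hτcyc.2]⟩
  have tip_orderp : cyc P cp (τ 1) < cyc P cp (τ (1 + 1)) ∧ cyc P cp (τ (1 + 1)) < cyc P cp (τ (1 + 2)) ∧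
      cyc P cp (τ (1 + 2)) < cyc P cp (τ (1 + 3)) := by
    simp only [show (1 : Fin 4) + 1 = 2 from rfl, show (1 : Fin 4) + 2 = 3 from rfl, show (1 : Fin 4) + 3 = 0 from rfl]
    rw [linp0, linp (τ 1) hτ1.1 hτ1.2 hd1.1, linp (τ 2) hτ2.1 hτ2.2 hd2.1, linp (τ 3) hτ3.1 hτ3.2 hd3.1]
    exact ⟨by linarith [hτcyc.1], by linarith [hτcyc.2], by linarith [hd3.2]⟩
  -- exactly one parity fits
  by_cases hpar : c₀ = decide ((kt : ℕ) % 2 = 0)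
  · refine ⟨cm, hcm_range.1, hcm_range.2, 0, kt, tip_orderm, tgt_orderm, tip_farm, tgt_farm, ?_⟩
    have e : decide (((0 : Fin 4) : ℕ) % 2 = 1) = false := by decide
    rw [e, Bool.xor_false]
    exact hpar
  · refine ⟨cp, hcp_range.1, hcp_range.2, 1, kt, tip_orderp, tgt_orderp, tip_farp, tgt_farp, ?_⟩
    have e : decide (((1 : Fin 4) : ℕ) % 2 = 1) = true := by decide
    rw [e, Bool.xor_true]
    cases c₀ <;> cases hk : decide ((kt : ℕ) % 2 = 0) <;> simp_all

/-! ### The lanes -/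

/-- **The level of the arm `q`** (reading order after the cut): right-movers `T q < G q` get the
levels `3 - q` (decreasing), left-movers the levels `4 + q` (increasing, above all right-movers). [folklore] -/
def laneLevel (T G : Fin 4 → ℤ) (q : Fin 4) : ℕ := if T q < G q then 3 - (q : ℕ) else 4 + (q : ℕ)

/-- Levels are `< 8`. [folklore] -/
theorem laneLevel_lt (T G : Fin 4 → ℤ) (q : Fin 4) : laneLevel T G q < 8 := by
  unfold laneLevel; have := q.isLt; split_ifs <;> omega

/-- The level map is injective. [folklore] -/
theorem laneLevel_injective (T G : Fin 4 → ℤ) {q q' : Fin 4} (h : laneLevel T G q = laneLevel T G q') : q = q' := by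
  unfold laneLevel at h
  have := q.isLt; have := q'.isLt
  apply Fin.ext
  split_ifs at h <;> omega

/-- **The lanes lemma.** Tips `T 0 < … < T 3` and targets `G 0 < … < G 3` on a line, no tip equal to
a target. For `q ≠ q'`: if the level of `q'` exceeds that of `q`, the tip `T q'` lies outside the
hull `[min (T q) (G q), max (T q) (G q)]`; if it is lower, the target `G q'` lies outside that hull.
(Right-movers before left-movers have disjoint hulls; two right-movers `q < q'` with overlapping
hulls have `level q' < level q`, two left-movers `q < q'` have `level q < level q'`.) [cite: Nolin2008, §4.3 Prop. 12 (i) (arXiv 0711.4948: Prop. 11; non-crossing corridors to prescribed landing areas)] -/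
theorem lanes_linear {T G : Fin 4 → ℤ} (hT : StrictMono T) (hG : StrictMono G) (hTG : ∀ q q', T q ≠ G q')
    {q q' : Fin 4} (hqq : q ≠ q') :
    (laneLevel T G q < laneLevel T G q' → T q' < min (T q) (G q) ∨ max (T q) (G q) < T q') ∧
      (laneLevel T G q' < laneLevel T G q → G q' < min (T q) (G q) ∨ max (T q) (G q) < G q') := by
  have hq := q.isLt; have hq' := q'.isLt
  have hne := hTG q q
  have hne' := hTG q' q'
  rcases lt_or_gt_of_ne hqq with hlt | hlt
  · have hT' := hT hlt
    have hG' := hG hlt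
    have hlt' : (q : ℕ) < q' := hlt
    unfold laneLevel
    constructor <;> intro h <;> split_ifs at h <;> simp only [min_def, max_def] <;> split_ifs <;> omega
  · have hT' := hT hlt
    have hG' := hG hlt
    have hlt' : (q' : ℕ) < q := hlt
    unfold laneLevel
    constructor <;> intro h <;> split_ifs at h <;> simp only [min_def, max_def] <;> split_ifs <;> omega

end Lanes

end Literature.Probability.Percolation
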